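import Literature.MathematicalPhysics.QuantumFieldTheory.Balaban1983to89.B12RTGaugeInvariance254
import Summits.QuantumFields.YangMills.Theorems.BalabanUVNodesN09CentralWindowAtRecord
import HarnessLib

/-!
# LINE g18-2 «wreg_chart» (20520 organ WREG) — EDGE engine, part 3: GAUGE COVARIANCE of the one-variable chain of the iterated (0.4) averaging and
# GAUGE INVARIANCE of its iterated central windows

Cell `ym3-torus`, width seat `ym3-torus-px17` g6 (helper of `stmt-QuantumFields-20520`, `--supports`, count-neutral).  As in part 2 the chain objects
enter as arbitrary families `icb` ∕ `cm` ∕ `cw` under their recursion equations.  Every group `G`, every COVARIANT one-step averaging family for §1;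
Bałaban's (0.4) block averaging `blockAvg ℰ` (any small-loop average `ℰ`) for §2–§3.

CONTENT.  §1 ★ `exists_fineLift` — every coarse gauge transformation `w` on `T⁽ⁿ⁾` is realised by a FINE one `u` on `T⁽⁰⁾` with
`Ū⁽ⁿ⁾(U^u) = (Ū⁽ⁿ⁾U)^w`, together with realising transformations at every intermediate level (iterated block-constant lifts, [Balaban1987RG1] p.265
«The gauge covariance of the averages…», tree `B12RTGaugeInvariance254.avg_gaugeAct_liftTransf`); §2 ★ `cm_gaugeAct` — the chain is COVARIANT:
`cm n (U^u) c (u(β₋)·g·u(β₊)⁻¹) = w(c₋)·cm n U c g·w(c₊)⁻¹`; `dist1_coord_gaugeAct` — the W-coordinates of a central window are gauge-INVARIANT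
(`loopHol_update_centralBond_self`, `loopHol_gaugeAct`, `dist1_conj`); §3 ★★ `mem_cw_gaugeAct_iff` ∕ `image_cw_gaugeAct` — the iterated window is
gauge-invariant and the IMAGE WINDOW of the chain transforms by the two-sided translation `x ↦ w(c₋)·x·w(c₊)⁻¹`.

HONEST FRAMING.  Algebra of [Balaban1985Averaging] (8)–(11) iterated; nothing of Bałaban's estimates is asserted; EDGE is assembled in part 4; WREG, S2β,
`FluctuationComparisonRegPrIntL` (20520) and every other crux are NOT proved; rung R3 = YM₃ on T³ — NOT d = 4, NOT infinite volume, NOT a mass gap, NOT Clay.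
-/

noncomputable section

open Set Function
open Literature.MathematicalPhysics.QuantumFieldTheory.Balaban1983to89
open Literature.MathematicalPhysics.QuantumFieldTheory.Balaban1983to89.BlockAveraging (Idx avgFun loopHol)
open Literature.MathematicalPhysics.QuantumFieldTheory.Balaban1983to89.BlockAveragingHaarAC (centralBond pre post)
open Literature.MathematicalPhysics.QuantumFieldTheory.Balaban1983to89.BlockAveragingEMLHaarAC (fibreFamily loopHol_update_centralBond_self)
open Literature.MathematicalPhysics.QuantumFieldTheory.Balaban1983to89.B12RTGaugeInvariance254 (liftTransf avg_gaugeAct_liftTransf)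

namespace Summit.QuantumFields.YangMills.Theorems.FluctuationComparisonRegPrIntLWregChartChainCovariance

variable {P : Params} {G : Type*} [GaugeGroup G]

/-! ## §1  Fine realisation of coarse gauge transformations along the averaging tower -/

/-- ★ **EVERY COARSE GAUGE TRANSFORMATION IS REALISED BY A FINE ONE ALONG THE WHOLE TOWER** (`n ≤ m + K`): for `w : T⁽ⁿ⁾ → G` there is `u : T⁽⁰⁾ → G` with
`Ū⁽ⁿ⁾(U^u) = (Ū⁽ⁿ⁾U)^w` for all `U`, and at every level `k ≤ n` some `v_k` with `Ū⁽ᵏ⁾(U^u) = (Ū⁽ᵏ⁾U)^{v_k}` (iterated block-constant lifts + one-step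
covariance of the averaging). [cite: Balaban1987RG1, (2.1) p.265; Balaban1985Averaging, (11) p.19] -/
theorem exists_fineLift (av : ∀ j, Averaging P j G) :
    ∀ {n : ℕ}, n ≤ P.m + P.K → ∀ (w : GaugeTransf P n G), ∃ u : GaugeTransf P 0 G,
      (∀ U : GaugeField P 0 G, Averaging.iter av n (GaugeField.gaugeAct u U) = GaugeField.gaugeAct w (Averaging.iter av n U)) ∧
      (∀ k, k ≤ n → ∃ v : GaugeTransf P k G,
        ∀ U : GaugeField P 0 G, Averaging.iter av k (GaugeField.gaugeAct u U) = GaugeField.gaugeAct v (Averaging.iter av k U)) := by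
  intro n
  induction n with
  | zero =>
      intro _ w
      refine ⟨w, fun U => rfl, fun k hk => ?_⟩
      obtain rfl : k = 0 := Nat.le_zero.1 hk
      exact ⟨w, fun U => rfl⟩
  | succ n IH =>
      intro hn w
      obtain ⟨u, hu, hfam⟩ := IH (by omega) (liftTransf w)
      have htop : ∀ U : GaugeField P 0 G,
          Averaging.iter av (n + 1) (GaugeField.gaugeAct u U) = GaugeField.gaugeAct w (Averaging.iter av (n + 1) U) := by
        intro U
        show (av n).avg (Averaging.iter av n (GaugeField.gaugeAct u U)) = GaugeField.gaugeAct w ((av n).avg (Averaging.iter av n U))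
        rw [hu U, avg_gaugeAct_liftTransf hn (av n) w]
      refine ⟨u, htop, fun k hk => ?_⟩
      rcases Nat.lt_or_ge k (n + 1) with hlt | hge
      · exact hfam k (by omega)
      · obtain rfl : k = n + 1 := le_antisymm hk hge
        exact ⟨w, htop⟩

/-! ## §2  Covariance of the chain; invariance of the window coordinates -/

/-- Updating the pivot bond and gauge transforming commute, with the pivot value transformed at the pivot's endpoints. [cite: Balaban1985Averaging, (8) p.19] -/
theorem update_gaugeAct {j : ℕ} (u : GaugeTransf P j G) (U : GaugeField P j G) (b : PBond P j) (g : G) :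
    update (GaugeField.gaugeAct u U) b (u b.src * g * (u b.tgt)⁻¹) = GaugeField.gaugeAct u (update U b g) := by
  funext b'
  by_cases hb : b' = b
  · subst hb; simp [GaugeField.gaugeAct]
  · rw [update_of_ne hb]
    simp [GaugeField.gaugeAct, update_of_ne hb]

/-- ★ **THE CHAIN IS GAUGE COVARIANT**: if `Ū⁽ⁿ⁾(U^u) = (Ū⁽ⁿ⁾U)^w` for all `U`, then
`cm n (U^u) c (u(βₙc)₋ · g · u(βₙc)₊⁻¹) = w(c₋) · cm n U c g · w(c₊)⁻¹`. [cite: Balaban1985Averaging, (11) p.19; Balaban1987RG1, (0.4) p.253] -/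
theorem cm_gaugeAct (ℰ : LoopAverage G) (icb : (n : ℕ) → PBond P n → PBond P 0)
    (cm : (n : ℕ) → GaugeField P 0 G → PBond P n → G → G)
    (hcm : ∀ n U c g, cm n U c g = Averaging.iter (fun i => BlockAveraging.blockAvg (P := P) (j := i) ℰ) n (update U (icb n c) g) c)
    {n : ℕ} (u : GaugeTransf P 0 G) (w : GaugeTransf P n G)
    (huw : ∀ U : GaugeField P 0 G, Averaging.iter (fun i => BlockAveraging.blockAvg (P := P) (j := i) ℰ) n (GaugeField.gaugeAct u U) =
      GaugeField.gaugeAct w (Averaging.iter (fun i => BlockAveraging.blockAvg (P := P) (j := i) ℰ) n U))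
    (U : GaugeField P 0 G) (c : PBond P n) (g : G) :
    cm n (GaugeField.gaugeAct u U) c (u (icb n c).src * g * (u (icb n c).tgt)⁻¹) = w c.src * cm n U c g * (w c.tgt)⁻¹ := by
  rw [hcm, hcm, update_gaugeAct, huw]
  rfl

/-- ★ **THE WINDOW COORDINATES ARE GAUGE INVARIANT**: the `dist1` of the W-coordinates of the central window at `(W^v, c)`, read at the transformed pivot
value `v(β c)₋·h·v(β c)₊⁻¹`, equal those at `(W, c)` read at `h` — the coordinates are the loop variables of `W[β c ↦ h]` (`loopHol_update_centralBond_self`),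
which transform by conjugation (`loopHol_gaugeAct`), and `dist1` is conjugation invariant. [cite: Balaban1985Averaging, (8) p.18 and (12) p.19; Balaban1987RG1, (0.4) p.253] -/
theorem dist1_coord_gaugeAct {j : ℕ} (hj : j + 1 ≤ P.m + P.K) (v : GaugeTransf P j G) (W : GaugeField P j G) (c : PBond P (j + 1)) (h : G) (i : Idx P) :
    dist1 (fibreFamily (GaugeField.gaugeAct v W) c
        (pre (GaugeField.gaugeAct v W) c * (v (centralBond c).src * h * (v (centralBond c).tgt)⁻¹) * post (GaugeField.gaugeAct v W) c) i) =
      dist1 (fibreFamily W c (pre W c * h * post W c) i) := by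
  have h1 := congrFun (loopHol_update_centralBond_self hj (GaugeField.gaugeAct v W) c (v (centralBond c).src * h * (v (centralBond c).tgt)⁻¹)) i
  have h2 := congrFun (loopHol_update_centralBond_self hj W c h) i
  rw [← h1, ← h2, update_gaugeAct, BlockAveraging.loopHol_gaugeAct, GaugeGroup.dist1_conj]

/-! ## §3  Gauge invariance of the iterated window; the image window transforms by a two-sided translation -/

/-- ★★ **THE ITERATED WINDOW IS GAUGE INVARIANT** (`n ≤ m + K`): if `u` is realised at every level `k ≤ n` (`Ū⁽ᵏ⁾(U^u) = (Ū⁽ᵏ⁾U)^{v_k}`), then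
`g ∈ cw n U c ↔ u(βₙc)₋·g·u(βₙc)₊⁻¹ ∈ cw n (U^u) c`. [cite: Balaban1987RG1, (0.4) p.253 and (2.1) p.265] -/
theorem mem_cw_gaugeAct_iff (ℰ : LoopAverage G) {α : ℝ} (icb : (n : ℕ) → PBond P n → PBond P 0)
    (cm : (n : ℕ) → GaugeField P 0 G → PBond P n → G → G) (cw : (n : ℕ) → GaugeField P 0 G → PBond P n → Set G)
    (hicbS : ∀ n (c : PBond P (n + 1)), icb (n + 1) c = icb n (centralBond c))
    (hcm : ∀ n U c g, cm n U c g = Averaging.iter (fun i => BlockAveraging.blockAvg (P := P) (j := i) ℰ) n (update U (icb n c) g) c)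
    (hcw0 : ∀ U c, cw 0 U c = univ)
    (hcwS : ∀ n U (c : PBond P (n + 1)), cw (n + 1) U c = {g | g ∈ cw n U (centralBond c) ∧
      cm n U (centralBond c) g ∈ {h : G | ∀ i : Idx P,
        dist1 (fibreFamily (Averaging.iter (fun i => BlockAveraging.blockAvg (P := P) (j := i) ℰ) n U) c
          (pre (Averaging.iter (fun i => BlockAveraging.blockAvg (P := P) (j := i) ℰ) n U) c * h *
            post (Averaging.iter (fun i => BlockAveraging.blockAvg (P := P) (j := i) ℰ) n U) c) i) ≤ α}})
    (u : GaugeTransf P 0 G) :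
    ∀ {n : ℕ}, n ≤ P.m + P.K →
      (∀ k, k ≤ n → ∃ v : GaugeTransf P k G, ∀ U : GaugeField P 0 G,
        Averaging.iter (fun i => BlockAveraging.blockAvg (P := P) (j := i) ℰ) k (GaugeField.gaugeAct u U) =
          GaugeField.gaugeAct v (Averaging.iter (fun i => BlockAveraging.blockAvg (P := P) (j := i) ℰ) k U)) →
      ∀ (U : GaugeField P 0 G) (c : PBond P n) (g : G),
        g ∈ cw n U c ↔ u (icb n c).src * g * (u (icb n c).tgt)⁻¹ ∈ cw n (GaugeField.gaugeAct u U) c := by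
  intro n
  induction n with
  | zero =>
      intro _ _ U c g
      simp [hcw0]
  | succ n IH =>
      intro hn hfam U c g
      obtain ⟨v, hv⟩ := hfam n (by omega)
      have IH' := IH (by omega) (fun k hk => hfam k (by omega)) U (centralBond c) g
      have hcov := cm_gaugeAct ℰ icb cm hcm u v hv U (centralBond c) g
      rw [hcwS, hcwS]
      simp only [mem_setOf_eq]
      rw [hicbS, ← IH', hcov, hv U]
      simp only [dist1_coord_gaugeAct (by omega) v]

/-- ★★ **THE IMAGE WINDOW OF THE CHAIN TRANSFORMS BY A TWO-SIDED TRANSLATION** (`n ≤ m + K`): with `u` realised at every level and `Ū⁽ⁿ⁾(U^u) = (Ū⁽ⁿ⁾U)^w`,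
`cm n (U^u) c '' cw n (U^u) c = (x ↦ w(c₋)·x·w(c₊)⁻¹) '' (cm n U c '' cw n U c)`. [cite: Balaban1987RG1, (0.4) p.253 and (2.1) p.265] -/
theorem image_cw_gaugeAct (ℰ : LoopAverage G) {α : ℝ} (icb : (n : ℕ) → PBond P n → PBond P 0)
    (cm : (n : ℕ) → GaugeField P 0 G → PBond P n → G → G) (cw : (n : ℕ) → GaugeField P 0 G → PBond P n → Set G)
    (hicbS : ∀ n (c : PBond P (n + 1)), icb (n + 1) c = icb n (centralBond c))
    (hcm : ∀ n U c g, cm n U c g = Averaging.iter (fun i => BlockAveraging.blockAvg (P := P) (j := i) ℰ) n (update U (icb n c) g) c)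
    (hcw0 : ∀ U c, cw 0 U c = univ)
    (hcwS : ∀ n U (c : PBond P (n + 1)), cw (n + 1) U c = {g | g ∈ cw n U (centralBond c) ∧
      cm n U (centralBond c) g ∈ {h : G | ∀ i : Idx P,
        dist1 (fibreFamily (Averaging.iter (fun i => BlockAveraging.blockAvg (P := P) (j := i) ℰ) n U) c
          (pre (Averaging.iter (fun i => BlockAveraging.blockAvg (P := P) (j := i) ℰ) n U) c * h *
            post (Averaging.iter (fun i => BlockAveraging.blockAvg (P := P) (j := i) ℰ) n U) c) i) ≤ α}})
    {n : ℕ} (hn : n ≤ P.m + P.K) (u : GaugeTransf P 0 G) (w : GaugeTransf P n G)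
    (huw : ∀ U : GaugeField P 0 G, Averaging.iter (fun i => BlockAveraging.blockAvg (P := P) (j := i) ℰ) n (GaugeField.gaugeAct u U) =
      GaugeField.gaugeAct w (Averaging.iter (fun i => BlockAveraging.blockAvg (P := P) (j := i) ℰ) n U))
    (hfam : ∀ k, k ≤ n → ∃ v : GaugeTransf P k G, ∀ U : GaugeField P 0 G,
        Averaging.iter (fun i => BlockAveraging.blockAvg (P := P) (j := i) ℰ) k (GaugeField.gaugeAct u U) =
          GaugeField.gaugeAct v (Averaging.iter (fun i => BlockAveraging.blockAvg (P := P) (j := i) ℰ) k U))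
    (U : GaugeField P 0 G) (c : PBond P n) :
    cm n (GaugeField.gaugeAct u U) c '' cw n (GaugeField.gaugeAct u U) c =
      (fun x : G => w c.src * x * (w c.tgt)⁻¹) '' (cm n U c '' cw n U c) := by
  have hmem := mem_cw_gaugeAct_iff ℰ icb cm cw hicbS hcm hcw0 hcwS u hn hfam U c
  have hwin : cw n (GaugeField.gaugeAct u U) c = (fun g => u (icb n c).src * g * (u (icb n c).tgt)⁻¹) '' cw n U c := by
    ext g'
    refine ⟨fun hg' => ?_, ?_⟩
    · refine ⟨(u (icb n c).src)⁻¹ * g' * u (icb n c).tgt, ?_, by group⟩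
      rw [hmem]
      have : u (icb n c).src * ((u (icb n c).src)⁻¹ * g' * u (icb n c).tgt) * (u (icb n c).tgt)⁻¹ = g' := by group
      rwa [this]
    · rintro ⟨g, hg, rfl⟩
      exact (hmem g).1 hg
  rw [hwin, image_image, image_image]
  exact image_congr fun g _ => cm_gaugeAct ℰ icb cm hcm u w huw U c g

end Summit.QuantumFields.YangMills.Theorems.FluctuationComparisonRegPrIntLWregChartChainCovariance

end
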